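/-
Copyright (c) 2026 the pub-hodgecm-mathlib formalisation cell (harness21).  Prover seat hodgecm-mathlib-LH4-p06 (g5), Track A «(D-RAM) FOUR-FRAME», unit U2H, census leaf
(ρ2b′-X) `stub_U2H_fixedPointCensus_typeTwo_unit0` — SOCKET (C) `orderCountCensusC` (type RamM): the (S-far) seam of LH4-p04 (g5)'s Compose (C) v4 — ★ WELD v2's
`hC2TOPfar` letter from the class letters, both regimes dispatched.  2026-09-04.
-/
import Summits.HodgeConjecture.HodgeConjecture.Theorems.F0P3cDyRamToricLevelCensusRamMTopCellsFar      -- ★ p858168 (this seat): even-class diagonal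
import Summits.HodgeConjecture.HodgeConjecture.Theorems.F0P3cDyRamToricLevelCensusRamMTopCellsOddFar   -- ★ p858319 (this seat): odd-class diagonal
import HarnessLib

/-!
# T5c (S-far): ★ `toricCensusSum_ramM_weld`'s `hC2TOPfar` letter from the (C-1cls) class letters and the (C-5b) side letters, both parity regimes

Cell `hodgecm-mathlib` (D-0151), FLOOR 0, crux H413 = `stmt-HodgeConjecture-24833`; squad F0∕P3c∕LH4; lane `--supports stmt-HodgeConjecture-24833 --as helper` (count-neutral).
THEOREMS ONLY (no `def`, no instance, no notation, no `sorry`, default heartbeats).  Socket served: LH4-p04 (g5)'s SOCKET (C), Compose (C) v4 seam (S-far): the hypothesis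
`hC2TOPfar` of ★ p858199 `toricCensusSum_ramM_weld` VERBATIM (`μ := λ − u`), for all far top cells at once, from: the frame; `v_h + d_ρ = 2e`, `v_{h′} + d_ρ = 2e′`; the
REGIME dichotomy `(m + s0 ≤ jλ ∧ (m + s0) % 2 = jλ % 2) ∨ jλ + 1 = m + s0` (★ S6b-RM `realizable_of_frame_ramM` + the parity tokens); `g + s0 ≤ m + 1`, `2s0 + g ≤ jλ + 2`;
the k₀-indexed class letters of ★ p858235∕p858252 (`hcls0 hclsT hclsO` for `h`, `hcls0′ hclsE hclsO′` for `h′`; (C-1cls)); ONE relative letter at the diagonal pair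
`(k₀, k₀′) = (m − jλ − e, m − jλ − e′)`; and the (C-5b) side letters GUARDED by regime (even: `TP∕TE` of `κ` at `c″ = s0 + 2g − 1`; odd: the literal bits of `η_h(k₀)` and
`η_{h′}(k₀′)` at `c″`).  Inside: the diagonal class parity `k₀ + s0 + e = m − jλ + s0` is even in the first regime and `1` in the second; dispatch to ★ p858168
(`ncard_levelSetDep_far_cast_eq_of_translator ∕ _of_anchor`) resp. ★ p858319 (`…_of_oddClass ∕ _of_oddClass_partner`).
HONEST LABEL.  Count-neutral (`--supports`); unconditional local algebra; nothing of (ρ2b′-X) is asserted — `HC_CM` is proved only modulo the 7 printed citations (2 remaining named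
inputs: hLiu418 = `stmt-HodgeConjecture-24832`, h413 = `stmt-HodgeConjecture-24833`) until rung 0 closes.

## References
* [Flicker1998UnitaryFL] Y. Z. Flicker, *Elementary proof of the fundamental lemma for a unitary group*, Canad. J. Math. 50 (1998): Prop. 7 p. 84.
* [Kottwitz1986BaseChangeUnits] R. E. Kottwitz, *Base change for unit elements of Hecke algebras*, Compositio Math. 60 (1986): §1 pp. 240–241.
* [Serre1979] J.-P. Serre, *Local Fields*, GTM 67 (1979): Ch. V §3 Prop. 5, Cor. 3; Ch. X §1.
-/

set_option autoImplicit false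

noncomputable section

namespace Summit.HodgeConjecture.HodgeConjecture.Cruxes.H413.F0P3cDyRamToricLevelCensusRamM

open WithZero IsLocalRing
open scoped Valued
open Literature.NumberTheory.Automorphic.UnitaryThreeFourFrame (IsRamifiedQuadraticDatum)
open Literature.NumberTheory.LocalFields.QuadraticOrder Literature.NumberTheory.LocalFields.WildQuadraticDatum
open Summit.HodgeConjecture.HodgeConjecture.Cruxes.H413.F0P3cDyRamToricCensusDefs

variable {K : Type} [Field K] [Valued K ℤᵐ⁰] {ρ Θ τ : K →+* K} {α ϖE h h' : K} {dρ t dτ tτ : ℕ}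
variable {K' : Type*} [Field K'] [Valued K' ℤᵐ⁰] {σ' : K' →+* K'} {π' : K'} {d' : ℕ}

/-- **(S-far): ★ WELD v2's `hC2TOPfar`, BOTH REGIMES.**  See the module docstring for the letters; the conclusion is the weld hypothesis verbatim with `μ := λ − u`.
[cite: Flicker1998UnitaryFL, Prop. 7 p. 84] [cite: Kottwitz1986BaseChangeUnits, §1 pp. 240–241] [cite: Serre1979, Ch. V §3 Prop. 5, Cor. 3; Ch. X §1] -/
theorem hC2TOPfar_of_letters [CompleteSpace K] [IsDiscreteValuationRing 𝒪[K]] [Finite 𝓀[K]] [IsDiscreteValuationRing 𝒪[K']] [Finite 𝓀[K']]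
    (hD : IsRamifiedQuadraticDatum ρ α dρ t) (hΘρ : ∀ x, Θ (ρ x) = ρ (Θ x)) (hvΘ : ∀ x, Valued.v (Θ x) = Valued.v x)
    (hτ : ∀ x, τ x = Θ (ρ x)) (hDτ : IsRamifiedQuadraticDatum τ α dτ tτ)
    {P : K} (hτP : τ P = P) (hP : Valued.v P = exp (-2 : ℤ)) {dK : ℕ} (hdK : Valued.v (P - ρ P) = exp (-(2 * (dK : ℤ))))
    (hσ' : ∀ x, σ' (σ' x) = x) (hvσ' : ∀ x, Valued.v (σ' x) = Valued.v x) (hfix' : ∀ x : K', σ' x = x → x ≠ 0 → ∃ n : ℤ, Valued.v x = exp (2 * n))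
    (hπ' : Valued.v π' = exp (-1 : ℤ)) (hdd' : Valued.v (π' - σ' π') = Valued.v π' ^ d')
    (jK : K' →+* K) (hjle : ∀ x y : K', Valued.v (jK x) ≤ Valued.v (jK y) ↔ Valued.v x ≤ Valued.v y) (hjΘ : ∀ x, Θ (jK x) = jK x)
    (hjfix : ∀ z : K, Θ z = z → ∃ x, jK x = z) (hjσ : ∀ x, jK (σ' x) = ρ (jK x)) (hjπ : Valued.v (jK π') = exp (-2 : ℤ))
    {ϖ : K} {dΘ tΘ : ℕ} (hDΘ : IsRamifiedQuadraticDatum Θ ϖ dΘ tΘ)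
    (hFN : ∀ f : K, ρ f = f → Θ f = f → Valued.v f = 1 → ∃ x : K, x * Θ x = f)
    {n₀ : K} (hΘn₀ : Θ n₀ = n₀) (hn₀1 : Valued.v n₀ = 1) (hn₀N : ¬ ∃ z : K, z * Θ z = n₀)
    (hϖE : Valued.v ϖE = exp (-2 : ℤ)) (hρϖ : ρ ϖE = ϖE) {q : ℕ} (hq : Nat.card 𝓀[K] = q) (hq' : Nat.card 𝓀[K'] = q) (hq2 : 2 ∣ q)
    (hΘh : Θ h = h) (hh : h ≠ 0) {vh : ℤ} (hvh : Valued.v h = exp (-vh))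
    (hΘh' : Θ h' = h') (hh' : h' ≠ 0) {vh' : ℤ} (hvh' : Valued.v h' = exp (-vh'))
    {lam u : K} (hlam : lam * Θ lam = 1) (hu : ρ u = u) (hu1 : u * Θ u = 1)
    {m jl : ℕ} (hμ : Valued.v (lam - u) = Valued.v ϖE ^ m) (hjl : Valued.v ((lam - u) - ρ (lam - u)) = Valued.v (ϖE ^ jl * (α - ρ α)))
    {g s0 : ℕ} (hg : dΘ = 2 * g) (hs0 : dτ = 2 * s0) (hd' : 2 * d' = dρ + dτ) (hdK2 : 2 * dK = dρ + 2 * g)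
    {e e' : ℤ} (he : vh + dρ = 2 * e) (he' : vh' + dρ = 2 * e')
    (hreg : (m + s0 ≤ jl ∧ (m + s0) % 2 = jl % 2) ∨ jl + 1 = m + s0) (hmd : g + s0 ≤ m + 1) (hjlS : 2 * s0 + g ≤ jl + 2)
    (hcls0 : ∀ k₀ : ℤ, Valued.v (1 + ρ h / h * (ρ (α ^ k₀ * Θ (α ^ k₀)) / (α ^ k₀ * Θ (α ^ k₀)))) ≤ exp (-(2 * (d' : ℤ) - 2)))
    (hclsT : ∀ k₀ : ℤ, (∃ r : ℤ, k₀ + s0 + e = 2 * r) → ∃ ω₀ : Kˣ, Valued.v (ω₀ : K) = 1 ∧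
      ρ h / h * (ρ (α ^ k₀ * Θ (α ^ k₀)) / (α ^ k₀ * Θ (α ^ k₀))) * (ρ ((ω₀ : K) * Θ ω₀) / ((ω₀ : K) * Θ ω₀)) = -1)
    (hclsO : ∀ k₀ : ℤ, (∃ r : ℤ, k₀ + s0 + e = 2 * r + 1) → ∀ ω : Kˣ, Valued.v (ω : K) = 1 →
      ¬ Valued.v (1 + ρ h / h * (ρ (α ^ k₀ * Θ (α ^ k₀)) / (α ^ k₀ * Θ (α ^ k₀))) * (ρ ((ω : K) * Θ ω) / ((ω : K) * Θ ω))) ≤ exp (-(2 * (d' : ℤ))))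
    (hcls0' : ∀ k₀ : ℤ, Valued.v (1 + ρ h' / h' * (ρ (α ^ k₀ * Θ (α ^ k₀)) / (α ^ k₀ * Θ (α ^ k₀)))) ≤ exp (-(2 * (d' : ℤ) - 2)))
    (hclsE : ∀ k₀ : ℤ, (∃ r : ℤ, k₀ + s0 + e' = 2 * r) → ∃ ω₀ : Kˣ, Valued.v (ω₀ : K) = 1 ∧
      ρ h' / h' * (ρ (α ^ k₀ * Θ (α ^ k₀)) / (α ^ k₀ * Θ (α ^ k₀))) * (ρ ((ω₀ : K) * Θ ω₀) / ((ω₀ : K) * Θ ω₀)) * (ρ n₀ / n₀) = -1)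
    (hclsO' : ∀ k₀ : ℤ, (∃ r : ℤ, k₀ + s0 + e' = 2 * r + 1) → ∀ ω : Kˣ, Valued.v (ω : K) = 1 →
      ¬ Valued.v (1 + ρ h' / h' * (ρ (α ^ k₀ * Θ (α ^ k₀)) / (α ^ k₀ * Θ (α ^ k₀))) * (ρ ((ω : K) * Θ ω) / ((ω : K) * Θ ω))) ≤ exp (-(2 * (d' : ℤ))))
    {ω_r : Kˣ} (hω_r : Valued.v (ω_r : K) = 1)
    (hrel : ρ h' / h' * (ρ (α ^ ((m : ℤ) - jl - e') * Θ (α ^ ((m : ℤ) - jl - e'))) / (α ^ ((m : ℤ) - jl - e') * Θ (α ^ ((m : ℤ) - jl - e')))) =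
      ρ h / h * (ρ (α ^ ((m : ℤ) - jl - e) * Θ (α ^ ((m : ℤ) - jl - e))) / (α ^ ((m : ℤ) - jl - e) * Θ (α ^ ((m : ℤ) - jl - e)))) * (ρ n₀ / n₀) *
        (ρ ((ω_r : K) * Θ ω_r) / ((ω_r : K) * Θ ω_r)))
    (ε : ℚ)
    (hST : m + s0 ≤ jl → (∃ ω : K, Valued.v ω = 1 ∧
      Valued.v (ρ (lam - u) / (lam - u) * (ρ (ω * Θ ω) / (ω * Θ ω)) - 1) ≤ exp (-(2 * ((s0 : ℤ) + 2 * g - 1) + dρ))) → ε = 1)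
    (hSE : m + s0 ≤ jl → (∃ ω : K, Valued.v ω = 1 ∧
      Valued.v (ρ (lam - u) / (lam - u) * (ρ n₀ / n₀) * (ρ (ω * Θ ω) / (ω * Θ ω)) - 1) ≤ exp (-(2 * ((s0 : ℤ) + 2 * g - 1) + dρ))) → ε = -1)
    (hSP : jl + 1 = m + s0 → (∃ ω₁ : Kˣ, Valued.v (ω₁ : K) = 1 ∧
      Valued.v (1 + ρ h / h * (ρ (α ^ ((m : ℤ) - jl - e) * Θ (α ^ ((m : ℤ) - jl - e))) / (α ^ ((m : ℤ) - jl - e) * Θ (α ^ ((m : ℤ) - jl - e)))) /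
        (ρ (lam - u) / (lam - u)) * (ρ ((ω₁ : K) * Θ ω₁) / ((ω₁ : K) * Θ ω₁))) ≤ exp (-(2 * ((s0 : ℤ) + 2 * g - 1) + dρ))) → ε = 1)
    (hSM : jl + 1 = m + s0 → (∃ ω₁ : Kˣ, Valued.v (ω₁ : K) = 1 ∧
      Valued.v (1 + ρ h' / h' * (ρ (α ^ ((m : ℤ) - jl - e') * Θ (α ^ ((m : ℤ) - jl - e'))) / (α ^ ((m : ℤ) - jl - e') * Θ (α ^ ((m : ℤ) - jl - e')))) /
        (ρ (lam - u) / (lam - u)) * (ρ ((ω₁ : K) * Θ ω₁) / ((ω₁ : K) * Θ ω₁))) ≤ exp (-(2 * ((s0 : ℤ) + 2 * g - 1) + dρ))) → ε = -1) :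
    ∀ j a, j ≤ jl → a ≤ j → ¬ (a ≤ m ∧ (j + a ≤ m ∨ (2 * a ≤ m ∧ j + a ≤ jl))) → j + m = jl + a → ¬ (j + a + 2 ≤ m + s0 + 2 * g) →
      (((levelSetDep ρ Θ α ϖE h j a (lam - u)).ncard : ℚ) =
          if 2 * j + (g + s0) ≤ 2 * jl + 1 ∧ ε = 1 then 2 * (q : ℚ) ^ (j - (j + a - m - s0 + 1) / 2) else 0) ∧
      (((levelSetDep ρ Θ α ϖE h' j a (lam - u)).ncard : ℚ) =
          if 2 * j + (g + s0) ≤ 2 * jl + 1 ∧ ε = -1 then 2 * (q : ℚ) ^ (j - (j + a - m - s0 + 1) / 2) else 0) := by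
  intro j a hj _ hng hdiag hfar
  have hTE : ¬ (ε = 1 ∧ ε = -1) := fun h1 => by rw [h1.1] at h1; norm_num at h1
  have hk₀ : vh + dρ + 2 * ((m : ℤ) - jl - e) + 2 * jl = 2 * m := by omega
  have hk₀' : vh' + dρ + 2 * ((m : ℤ) - jl - e') + 2 * jl = 2 * m := by omega
  rcases hreg with ⟨hA, hpar⟩ | hoff
  · ---------------------------------------------------------------- even-class diagonal (on-parity rows)
    obtain ⟨ω₀, hω₀, hη⟩ := hclsT ((m : ℤ) - jl - e) ⟨((m : ℤ) + s0 - jl) / 2, by omega⟩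
    obtain ⟨ω₀', hω₀', hη'⟩ := hclsE ((m : ℤ) - jl - e') ⟨((m : ℤ) + s0 - jl) / 2, by omega⟩
    exact ⟨ncard_levelSetDep_far_cast_eq_of_translator hD hΘρ hvΘ hτ hDτ hτP hP hdK hσ' hvσ' hfix' hπ' hdd' jK hjle hjΘ hjfix hjσ hjπ hDΘ hFN hΘn₀ hn₀1 hn₀N
        hϖE hρϖ hq hq' hq2 hh hvh hlam hu hu1 hμ hjl hg hs0 hd' hdK2 (Or.inl hA) hjlS (ε = 1) (ε = -1) (hST hA) (hSE hA) hTE hk₀ hω₀ hη hj hng hdiag hfar,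
      ncard_levelSetDep_far_cast_eq_of_anchor hD hΘρ hvΘ hτ hDτ hτP hP hdK hσ' hvσ' hfix' hπ' hdd' jK hjle hjΘ hjfix hjσ hjπ hDΘ hFN hΘn₀ hn₀1 hn₀N
        hϖE hρϖ hq hq' hq2 hh' hvh' hlam hu hu1 hμ hjl hg hs0 hd' hdK2 (Or.inl hA) hjlS (ε = 1) (ε = -1) (hST hA) (hSE hA) hTE hk₀' hω₀' hη' hj hng hdiag hfar⟩
  · ---------------------------------------------------------------- odd-class diagonal (off-parity rows `jλ + 1 = m + s0`)
    have hodd := hclsO ((m : ℤ) - jl - e) ⟨0, by omega⟩ 1 (by rw [Units.val_one, Valuation.map_one])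
    have hodd' := hclsO' ((m : ℤ) - jl - e') ⟨0, by omega⟩ 1 (by rw [Units.val_one, Valuation.map_one])
    simp only [Units.val_one, map_one, div_one, mul_one] at hodd hodd'
    exact ⟨ncard_levelSetDep_far_cast_eq_of_oddClass hD hΘρ hvΘ hτ hDτ hτP hP hdK hσ' hvσ' hfix' hπ' hdd' jK hjle hjΘ hjfix hjσ hjπ hDΘ hFN hΘn₀ hn₀1 hn₀N
        hϖE hρϖ hq hq' hq2 hΘh hh hvh hlam hu hu1 hμ hjl hg hs0 hd' hdK2 hoff hmd hk₀ (hcls0 _) hodd hω_r hrel (ε = 1) (ε = -1) (hSP hoff) (hSM hoff) hTE hj hng hdiag hfar,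
      ncard_levelSetDep_far_cast_eq_of_oddClass_partner hD hΘρ hvΘ hτ hDτ hτP hP hdK hσ' hvσ' hfix' hπ' hdd' jK hjle hjΘ hjfix hjσ hjπ hDΘ hFN hΘn₀ hn₀1 hn₀N
        hϖE hρϖ hq hq' hq2 hh hΘh' hh' hvh' hlam hu hu1 hμ hjl hg hs0 hd' hdK2 hoff hmd hk₀' (hcls0' _) hodd' hω_r hrel (ε = 1) (ε = -1) (hSP hoff) (hSM hoff) hTE
        hj hng hdiag hfar⟩

/-- **(S-near): ★ WELD v2's `hC2TOPnear`** — ★ p858164 `ncard_levelSetDep_top_eq_of_near` at the diagonal pair `(k₀, k₀′) = (m − jλ − e, m − jλ − e′)`, conclusion verbatim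
(`μ := λ − u`). [cite: Serre1979, Ch. V §3 Cor. 3] [cite: Flicker1998UnitaryFL, Prop. 7 p. 84] -/
theorem hC2TOPnear_of_letters [CompleteSpace K] [IsDiscreteValuationRing 𝒪[K]] [Finite 𝓀[K]]
    (hD : IsRamifiedQuadraticDatum ρ α dρ t) (hΘρ : ∀ x, Θ (ρ x) = ρ (Θ x)) (hvΘ : ∀ x, Valued.v (Θ x) = Valued.v x)
    (hϖE : Valued.v ϖE = exp (-2 : ℤ)) (hρϖ : ρ ϖE = ϖE) {q : ℕ} (hq : Nat.card 𝓀[K] = q)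
    (hσ' : ∀ x, σ' (σ' x) = x) (hvσ' : ∀ x, Valued.v (σ' x) = Valued.v x) (hfix' : ∀ x : K', σ' x = x → x ≠ 0 → ∃ n : ℤ, Valued.v x = exp (2 * n))
    (hπ' : Valued.v π' = exp (-1 : ℤ)) (hdd' : Valued.v (π' - σ' π') = Valued.v π' ^ d')
    (jK : K' →+* K) (hjle : ∀ x y : K', Valued.v (jK x) ≤ Valued.v (jK y) ↔ Valued.v x ≤ Valued.v y) (hjΘ : ∀ x, Θ (jK x) = jK x)
    (hjfix : ∀ z : K, Θ z = z → ∃ x, jK x = z) (hjσ : ∀ x, jK (σ' x) = ρ (jK x)) (hjπ : Valued.v (jK π') = exp (-2 : ℤ))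
    {ϖ : K} {dΘ tΘ : ℕ} (hDΘ : IsRamifiedQuadraticDatum Θ ϖ dΘ tΘ)
    (hFN : ∀ f : K, ρ f = f → Θ f = f → Valued.v f = 1 → ∃ x : K, x * Θ x = f)
    {n₀ : K} (hΘn₀ : Θ n₀ = n₀) (hn₀1 : Valued.v n₀ = 1) (hn₀N : ¬ ∃ z : K, z * Θ z = n₀)
    (hh : h ≠ 0) {vh : ℤ} (hvh : Valued.v h = exp (-vh)) (hh' : h' ≠ 0) {vh' : ℤ} (hvh' : Valued.v h' = exp (-vh'))
    {lam u : K} {m jl : ℕ} (hμ : Valued.v (lam - u) = Valued.v ϖE ^ m) (hjl : Valued.v ((lam - u) - ρ (lam - u)) = Valued.v (ϖE ^ jl * (α - ρ α)))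
    {g s0 : ℕ} (hg : dΘ = 2 * g) (hs0 : dτ = 2 * s0) (hd' : 2 * d' = dρ + dτ)
    {e e' : ℤ} (he : vh + dρ = 2 * e) (he' : vh' + dρ = 2 * e')
    {ω_r : Kˣ} (hω_r : Valued.v (ω_r : K) = 1)
    (hrel : ρ h' / h' * (ρ (α ^ ((m : ℤ) - jl - e') * Θ (α ^ ((m : ℤ) - jl - e'))) / (α ^ ((m : ℤ) - jl - e') * Θ (α ^ ((m : ℤ) - jl - e')))) =
      ρ h / h * (ρ (α ^ ((m : ℤ) - jl - e) * Θ (α ^ ((m : ℤ) - jl - e))) / (α ^ ((m : ℤ) - jl - e) * Θ (α ^ ((m : ℤ) - jl - e)))) * (ρ n₀ / n₀) *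
        (ρ ((ω_r : K) * Θ ω_r) / ((ω_r : K) * Θ ω_r))) :
    ∀ j a, j ≤ jl → a ≤ j → ¬ (a ≤ m ∧ (j + a ≤ m ∨ (2 * a ≤ m ∧ j + a ≤ jl))) → j + m = jl + a → j + a + 2 ≤ m + s0 + 2 * g →
      (levelSetDep ρ Θ α ϖE h j a (lam - u)).ncard = (levelSetDep ρ Θ α ϖE h' j a (lam - u)).ncard :=
  fun j a hj _ hng hdiag hnear =>
    ncard_levelSetDep_top_eq_of_near hD hΘρ hvΘ hϖE hρϖ hq hσ' hvσ' hfix' hπ' hdd' jK hjle hjΘ hjfix hjσ hjπ hDΘ hFN hΘn₀ hn₀1 hn₀N hh hvh hh' hvh' hμ hjl hg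
      (show 2 * d' = dρ + 2 * s0 by omega) (k₀ := (m : ℤ) - jl - e) (k₀' := (m : ℤ) - jl - e') (by omega) (by omega) hω_r hrel hj hng hdiag hnear

end Summit.HodgeConjecture.HodgeConjecture.Cruxes.H413.F0P3cDyRamToricLevelCensusRamM

end
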